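import Summits.CriticalPhenomena.PercolationContinuityZ3.Theorems.PercNearOneGluingNoHeavyPcintSiteZ4King
import Literature.Probability.Percolation.SquareSiteVdBergErmakov
import HarnessLib

/-!
# PCINT lane, king route: the site rows `d = 4, 5, 8` CONDITIONAL on van den Berg–Ermakov 1996

Cell `prim-pcint`, seat `prim-pcint-1` (gen 9).  Restatement of the conditional rows of
`…PcintSiteZ4King.lean` with the named fact `VandenBergErmakov1996SquareSite`
(`Literature/Probability/Percolation/SquareSiteVdBergErmakov.lean`, p326539: van den Berg–Ermakov, Random
Struct. Alg. 8 (1996), Thm. 1.1, `p_c^site(ℤ²) > 0.556`, NOT proved in the tree) as the hypothesis, in the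
shape of the Wierman-conditional rows of `SquareSiteWierman.lean`:

* `siteCriticalProb_Z4_lt_of_vdBergErmakov`: `p_c^site(ℤ⁴) < 0.444` (unconditional kernel cell `0.4685`;
  Wierman-conditional `0.4339`);
* `siteCriticalProb_Z5_le_of_vdBergErmakov`: `p_c^site(ℤ⁵) ≤ 0.425` (`0.4477`; `0.4153`);
* `siteCriticalProb_Z8_le_of_vdBergErmakov`: `p_c^site(ℤ⁸) ≤ 0.2544` (`0.271`; `0.2476`).
-/

noncomputable section

namespace Summit.CriticalPhenomena.PercolationContinuityZ3.Theorems.Pcint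

open Literature.Probability.Percolation Literature.Probability.LatticeModels

namespace KingCover

/-- **`p_c^site(ℤ⁴) < 0.444`, conditional on van den Berg–Ermakov 1996** (`p_c^site(ℤ²) > 0.556`), by the
king route `p_c^site(ℤ⁴) ≤ p_c^site(ℤ²∗) ≤ 1 - p_c^site(ℤ²)`. -/
theorem siteCriticalProb_Z4_lt_of_vdBergErmakov (h : VandenBergErmakov1996SquareSite) :
    siteCriticalProb (zdGraph 4) (0 : Site 4) < 0.444 :=
  siteCriticalProb_Z4_lt_of_Z2_gt_0556 h

/-- **`p_c^site(ℤ⁵) ≤ 0.425`, conditional on van den Berg–Ermakov 1996** (GPS crossover from `d = 4`). -/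
theorem siteCriticalProb_Z5_le_of_vdBergErmakov (h : VandenBergErmakov1996SquareSite) :
    siteCriticalProb (zdGraph 5) (0 : Site 5) ≤ 0.425 :=
  siteCriticalProb_Z5_le_of_Z2_gt_0556 h

/-- **`p_c^site(ℤ^d) ≤ 0.425` for `d ≥ 5`, conditional on van den Berg–Ermakov 1996.** -/
theorem siteCriticalProb_zd_le_of_vdBergErmakov_of_five_le (h : VandenBergErmakov1996SquareSite) {d : ℕ}
    (hd : 5 ≤ d) : siteCriticalProb (zdGraph d) (0 : Site d) ≤ 0.425 :=
  siteCriticalProb_zd_le_of_Z2_gt_0556_of_five_le h hd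

/-- **`p_c^site(ℤ⁸) ≤ 0.2544`, conditional on van den Berg–Ermakov 1996** (GPS Lemma 2, `k = 4`, `m = 2`). -/
theorem siteCriticalProb_Z8_le_of_vdBergErmakov (h : VandenBergErmakov1996SquareSite) :
    siteCriticalProb (zdGraph 8) (0 : Site 8) ≤ 0.2544 :=
  siteCriticalProb_Z8_le_of_Z2_gt_0556 h

/-- **`p_c^site(ℤ^d) ≤ 0.2544` for `d ≥ 8`, conditional on van den Berg–Ermakov 1996.** -/
theorem siteCriticalProb_zd_le_of_vdBergErmakov_of_eight_le (h : VandenBergErmakov1996SquareSite) {d : ℕ}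
    (hd : 8 ≤ d) : siteCriticalProb (zdGraph d) (0 : Site d) ≤ 0.2544 :=
  siteCriticalProb_zd_le_of_Z2_gt_0556_of_eight_le h hd

end KingCover

end Summit.CriticalPhenomena.PercolationContinuityZ3.Theorems.Pcint

end
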